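import Summits.QuantumFields.GaugeBoot.OneOverNPlaquetteSymmetry
import Summits.QuantumFields.GaugeBoot.LimitingPartitionFunction
import HarnessLib

/-!
# The `1/N` expansion of the free energy, I: measurability of the coefficients and the boundary layer (gauge-boot, ADDENDUM 30 part J)

HONEST FRAMING (cell `pub-gaugeboot`, page 1 of every file): the venture produces certified bounds
on lattice expectations at stated coupling, gauge group, dimension and torus size; NOT a mass gap,
NOT a continuum limit, NOT a string tension; NOT Yang–Mills-summit-bearing (barriers
`FixedCouplingUltralocality`, `PerturbativeInvisibility`).  Strong-coupling `SO(N)` lattice gauge theory with free boundary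
condition (S. Chatterjee, Comm. Math. Phys. **366** (2019); S. Chatterjee, J. Jafarov, arXiv:1604.04777); nothing about
four-dimensional continuum Yang–Mills or a mass gap.

## Content

Preparations for the sibling `OneOverNFreeEnergy` (the `1/N` expansion of `log Z_{Λ_N,N,β}/(N²|Λ_N|)` to all orders):
* `antitone_of_succ_le` — bookkeeping of the thresholds `β₀(d,k)`;
* `aestronglyMeasurable_coeff`, `intervalIntegrable_coeff` — for any family `F` with the order-by-order convergence along
  super-logarithmic cubes and the bounds `|f_k| ≤ C_k L_k^{|s|}`, the coefficient `t ↦ f_k(t, (∂p))` is a pointwise limit of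
  continuous functions of the coupling on `[0, β]` (`|β| ≤ β₀(d,k)`), hence a.e.-strongly measurable and interval integrable;
* `one_sub_box_ratio_le` — the boundary layer of depth `R` of the cube `[−M, M]^d` has density `≤ d(R+1)/M` (Bernoulli).

Everything is `[folklore]`.
-/

noncomputable section

open Filter Topology MeasureTheory
open Literature.Probability.LatticeModels (Site box)
open Literature.MathematicalPhysics.QuantumLattice (ZdEdge ZdPlaquette)
open Literature.MathematicalPhysics.QuantumFieldTheory (latticeNorm plaquettesIn)
open Literature.MathematicalPhysics.QuantumFieldTheory.Chatterjee2019LargeN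
open Literature.MathematicalPhysics.QuantumFieldTheory.Chatterjee2019LargeN.CoeffCatalanBoundProof

namespace Summit.QuantumFields.GaugeBoot

namespace StringDuality

variable {d : ℕ}

/-- A sequence with `β₀(k+1) ≤ β₀(k)` is antitone. [folklore] -/
theorem antitone_of_succ_le {β₀ : ℕ → ℝ} (h : ∀ k, β₀ (k + 1) ≤ β₀ k) {i k : ℕ} (hik : i ≤ k) : β₀ k ≤ β₀ i := by
  induction k with
  | zero => obtain rfl : i = 0 := Nat.le_zero.mp hik; exact le_rfl
  | succ k ih =>
    rcases Nat.lt_or_ge i (k + 1) with hlt | hge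
    · exact (h k).trans (ih (Nat.lt_succ_iff.mp hlt))
    · obtain rfl : i = k + 1 := le_antisymm hik hge; exact le_rfl

/-- The squares `[−N², N²]^d` grow super-logarithmically. [folklore] -/
theorem superlog_sq (a : ℕ) : ∀ᶠ N : ℕ in atTop, a * Nat.log 2 N ≤ N * N := by
  filter_upwards [superlog_linear a] with N hN
  exact hN.trans (Nat.le_mul_self N)

/-! ## Measurability and integrability of the coefficients in the coupling -/

/-- **The coefficients are a.e.-strongly measurable in the coupling on `[0, β]`** (`|β| ≤ β₀(k)`): `t ↦ f_k(t, (∂p))` is the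
pointwise limit of the continuous functions `t ↦ N^k(φ_{[−N²,N²]^d,N,t}((∂p)) − Σ_{i<k} f_i(t,(∂p))N^{−i})`. [folklore] -/
theorem aestronglyMeasurable_coeff {F : ℕ → ℝ → LoopSeq d → ℝ} {β₀ : ℕ → ℝ} (hanti : ∀ k, β₀ (k + 1) ≤ β₀ k)
    (hConv : ∀ (k : ℕ) (β : ℝ), |β| ≤ β₀ k → ∀ M : ℕ → ℕ, (∀ a : ℕ, ∀ᶠ N : ℕ in atTop, a * Nat.log 2 N ≤ M N) →
      ∀ s : LoopSeq d, IsLoopSeq s → Tendsto (fun N : ℕ => (N : ℝ) ^ k *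
        (phi N β (box d (M N)) s - ∑ i ∈ Finset.range k, F (i + 2) β s / (N : ℝ) ^ i)) atTop (𝓝 (F (k + 2) β s))) :
    ∀ (k : ℕ) (β : ℝ), |β| ≤ β₀ k → ∀ p : ZdPlaquette d,
      AEStronglyMeasurable (fun t : ℝ => F (k + 2) t [plaquetteWord p]) (volume.restrict (Set.uIoc 0 β)) := by
  intro k
  induction k using Nat.strong_induction_on with
  | _ k ih =>
    intro β hβ p
    -- the approximating continuous functions
    set h : ℕ → ℝ → ℝ := fun N t => (N : ℝ) ^ k *
      (phi N t (box d (N * N)) [plaquetteWord p] - ∑ i ∈ Finset.range k, F (i + 2) t [plaquetteWord p] / (N : ℝ) ^ i) with hh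
    have hmeas : ∀ N : ℕ, AEStronglyMeasurable (h N) (volume.restrict (Set.uIoc 0 β)) := by
      intro N
      have h1 : AEStronglyMeasurable (fun t : ℝ => phi N t (box d (N * N)) [plaquetteWord p])
          (volume.restrict (Set.uIoc 0 β)) :=
        (continuous_phi_coupling N (box d (N * N)) [plaquetteWord p]).aestronglyMeasurable
      have h2 : AEStronglyMeasurable (fun t : ℝ => ∑ i ∈ Finset.range k, F (i + 2) t [plaquetteWord p] * ((N : ℝ) ^ i)⁻¹)
          (volume.restrict (Set.uIoc 0 β)) := by
        refine Finset.aestronglyMeasurable_fun_sum (μ := volume.restrict (Set.uIoc 0 β)) (Finset.range k)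
          (f := fun (i : ℕ) (t : ℝ) => F (i + 2) t [plaquetteWord p] * ((N : ℝ) ^ i)⁻¹) fun i hi => ?_
        have hik : i < k := Finset.mem_range.mp hi
        exact AEStronglyMeasurable.mul_const (ih i hik β (hβ.trans (antitone_of_succ_le hanti hik.le)) p) _
      refine ((h1.sub h2).const_mul ((N : ℝ) ^ k)).congr (Eventually.of_forall fun t => ?_)
      simp only [hh, Pi.sub_apply, div_eq_mul_inv]
    refine aestronglyMeasurable_of_tendsto_ae atTop hmeas ?_
    rw [ae_restrict_iff' measurableSet_uIoc]
    refine ae_of_all _ fun t ht => ?_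
    exact hConv k t ((abs_le_of_mem_uIoc ht).trans hβ) (fun N => N * N) superlog_sq _ (isLoopSeq_plaquette p)

/-- **The coefficients are interval integrable in the coupling** on `[0, β]`, `|β| ≤ β₀(k)`. [folklore] -/
theorem intervalIntegrable_coeff {F : ℕ → ℝ → LoopSeq d → ℝ} {β₀ C L : ℕ → ℝ} (hanti : ∀ k, β₀ (k + 1) ≤ β₀ k)
    (hConv : ∀ (k : ℕ) (β : ℝ), |β| ≤ β₀ k → ∀ M : ℕ → ℕ, (∀ a : ℕ, ∀ᶠ N : ℕ in atTop, a * Nat.log 2 N ≤ M N) →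
      ∀ s : LoopSeq d, IsLoopSeq s → Tendsto (fun N : ℕ => (N : ℝ) ^ k *
        (phi N β (box d (M N)) s - ∑ i ∈ Finset.range k, F (i + 2) β s / (N : ℝ) ^ i)) atTop (𝓝 (F (k + 2) β s)))
    (hB : ∀ (k : ℕ) (β : ℝ), |β| ≤ β₀ k → ∀ s : LoopSeq d, IsLoopSeq s → |F (k + 2) β s| ≤ C k * L k ^ s.len) :
    ∀ (k : ℕ) (β : ℝ), |β| ≤ β₀ k → ∀ p : ZdPlaquette d,
      IntervalIntegrable (fun t : ℝ => F (k + 2) t [plaquetteWord p]) volume 0 β := by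
  intro k β hβ p
  refine IntervalIntegrable.mono_fun' (g := fun _ => C k * L k ^ LoopSeq.len [plaquetteWord p]) intervalIntegrable_const
    (aestronglyMeasurable_coeff hanti hConv k β hβ p) ?_
  rw [EventuallyLE, ae_restrict_iff' measurableSet_uIoc]
  refine ae_of_all _ fun t ht => ?_
  rw [Real.norm_eq_abs]
  exact hB k t ((abs_le_of_mem_uIoc ht).trans hβ) _ (isLoopSeq_plaquette p)

/-! ## The boundary layer of a cube -/

/-- **The boundary layer of depth `R` of `[−M, M]^d` has density at most `d(R+1)/M`**:
`1 − |[−(M−R−1), M−R−1]^d|/|[−M, M]^d| ≤ d (R+1)/M` (Bernoulli's inequality).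
[cite: Chatterjee2019LargeN, §15 («|𝒫'_N|/|Λ_N| → d(d−1)/2»)] -/
theorem one_sub_box_ratio_le {M R : ℕ} (hM : R + 1 ≤ M) :
    1 - ((box d (M - (R + 1))).card : ℝ) / (box d M).card ≤ (d : ℝ) * ((R : ℝ) + 1) / M := by
  have hM0 : (0 : ℝ) < M := by exact_mod_cast (by omega : 0 < M)
  have hden : (0 : ℝ) < 2 * (M : ℝ) + 1 := by positivity
  rw [card_box, card_box]
  push_cast [Nat.cast_sub hM]
  -- the ratio is `(1 + a)^d` with `a = −(2R+2)/(2M+1) ∈ [−1, 0]`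
  set a : ℝ := -((2 * (R : ℝ) + 2) / (2 * (M : ℝ) + 1)) with ha
  have hratio : (2 * ((M : ℝ) - ((R : ℝ) + 1)) + 1) ^ d / (2 * (M : ℝ) + 1) ^ d = (1 + a) ^ d := by
    rw [← div_pow, ha]
    congr 1
    field_simp
    ring
  rw [hratio]
  have ha2 : -2 ≤ a := by
    rw [ha, neg_le_neg_iff, div_le_iff₀ hden]
    have : (R : ℝ) + 1 ≤ M := by exact_mod_cast hM
    linarith
  have hbern := one_add_mul_le_pow ha2 d
  have hfrac : (d : ℝ) * -a ≤ (d : ℝ) * ((R : ℝ) + 1) / M := by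
    rw [ha, neg_neg, mul_div_assoc]
    refine mul_le_mul_of_nonneg_left ?_ (Nat.cast_nonneg d)
    rw [div_le_div_iff₀ hden hM0]
    nlinarith
  linarith

end StringDuality

end Summit.QuantumFields.GaugeBoot

end
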